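import Summits.BirchSwinnertonDyer.BirchSwinnertonDyer.Theorems.UniversalToricDescentFrobeniusReduction
import Literature.NumberTheory.GaloisRepresentations.TameInertiaGeneratorEvaluationProofs
import Literature.NumberTheory.GaloisRepresentations.InertiaHomFrobeniusTwist
import Literature.NumberTheory.GaloisRepresentations.ContinuousH1TrivialAction
import HarnessLib

/-!
# Route UniversalToricDescent — Greenberg–Vatsal Prop. (2.4) for an UNRAMIFIED module:
# `#H¹(K_{∞,w}, B) = #{b ∈ B : φ^{p^R} b = q_v^{p^R} b}` (`v ∤ p` finitely decomposed, `R ≫ 0`)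

Lead prover bsd-wall-utd-p1 g9 (`--supports stmt-BirchSwinnertonDyer-20399`; sequel of
`UniversalToricDescentLocalH1Count` and `UniversalToricDescentFrobeniusReduction`, memo
ALG-HALF-21845-LOCAL §3/§5: the VALUE of the local term `s_v`). Setting: `K` a number field, `κ` a
`ℤ_p`-extension, `v ∤ p` a place not split completely in `K_∞` (`Hi = Gal(K̄_v/K_{∞,w})`,
`I = I_{K_v} ≤ Hi`), `B` a finite discrete `p`-primary `Γ_{K_v}`-module (continuous action) on which
`I` acts TRIVIALLY (e.g. `E[p]` at a place of good reduction), `φ` an arithmetic Frobenius of `K_v`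
(`IsFrobPow φ 1`), `q_v = residueFieldCard K_v`.

* `natCard_invariants_eq_natCard_hom` — `H¹(I ∩ Hi, B)^{Hi} ≃ {f : I → B continuous homomorphism |
  Hi ≤ S_f}` where `S_f = {g : g • f(g⁻¹ x g) = f(x) ∀ x}` is the (twisted) stabiliser of `f`
  (trivial action: classes are cocycles are homomorphisms, `oneCocycleClass_injective_of_trivial`;
  the conjugation action `conjMap` on cocycles is `(g·φ)(x) = g • φ(g⁻¹ x g)`).
* **`exists_forall_natCard_subgroupH1_localSubgroup_eq`** — **there is `R₀` with, for all `R ≥ R₀`,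
  `#H¹(Hi, B) = #{b ∈ B : φ^{p^R} • b = q_v^{p^R} • b}`**: `#H¹(Hi, B) = #H¹(I, B)^{Hi}`
  (`natCard_subgroupH1_localSubgroup_eq_natCard_invariants`); the stabilisers `S_f` contain `I` and a
  common open normal `N₀`, so `Hi ≤ S_f ↔ φ^{p^R} ∈ S_f` (`exists_forall_localSubgroup_le_iff_pow_mem`);
  `φ^{p^R} ∈ S_f ↔ φ^{p^R} • f(σ₀) = q_v^{p^R} • f(σ₀)` for a tame `p`-generator `σ₀` (Serre's
  `f(τστ⁻¹) = q^m f(σ)`, `apply_conj_eq_pow_nsmul_of_isFrobPow`), and evaluation at `σ₀` is a bijection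
  onto `B` (`exists_absInertia_tame_generator`): Greenberg–Vatsal's "`H¹((ℚ_∞)_η, A) ≅ (A(−1))^{G/I}`,
  the invariants of the prime-to-`p` part of Frobenius".

THEOREMS ONLY; no definition, no named fact, no `sorry`. BSD is not advanced by this file.
References: [GreenbergVatsal2000] §2 Prop. (2.4) and proof (arXiv p. 22); [GreenbergLNM1716] §3;
[SerreInventiones1972] §1.3, §1.7 Prop. 5, §1.8 Prop. 6; [SerreGaloisCohomology1997] I §2.3, I §2.6 (b).
-/

set_option autoImplicit false
-- `…BirchSwinnertonDyer.BirchSwinnertonDyer.Theorems…` is the problem's mandated namespace (D-0017).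
set_option linter.dupNamespace false

noncomputable section

open scoped Classical

namespace Summit.BirchSwinnertonDyer.BirchSwinnertonDyer.Theorems.UniversalToricDescentUnramifiedLocalCount

open NumberField IsDedekindDomain Field ValuativeRel
open Literature.NumberTheory.EllipticCurves Literature.NumberTheory.GaloisRepresentations
  Literature.NumberTheory.GaloisRepresentations.IsNonarchimedeanLocalField
  IsDedekindDomain.HeightOneSpectrum ContinuousCohomology Topology
  Summit.BirchSwinnertonDyer.BirchSwinnertonDyer.Theorems.UniversalToricDescentLocalH1Count
  Summit.BirchSwinnertonDyer.BirchSwinnertonDyer.Theorems.UniversalToricDescentFrobeniusReduction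

/-! ### §1 Local Galois theory: invariant classes ↔ homomorphisms with large twisted stabiliser -/

section Local

variable {F : Type} [Field F] [ValuativeRel F] [TopologicalSpace F] [IsNonarchimedeanLocalField F]
variable {B : Type} [AddCommGroup B] [DistribMulAction (absoluteGaloisGroup F) B]
  [TopologicalSpace B] [DiscreteTopology B]

/-- **`H¹(I ∩ Hi, B)^{Hi} ≃ {f : I → B continuous hom | Hi ≤ S_f}`** for a subgroup `Hi ⊇ I = I_F` and a
discrete `Γ_F`-module `B` on which `I` acts trivially. On the left: the classes of
`H¹(I.subgroupOf Hi, B)` fixed by the conjugation action `conjMap` of every `h ∈ Hi`; on the right: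
continuous homomorphisms `f : I → B` with `h • f(h⁻¹ x h) = f(x)` for all `h ∈ Hi`, `x ∈ I`. (Trivial
action: classes = cocycles = homomorphisms.) [cite: SerreGaloisCohomology1997, I §2.3]
[cite: GreenbergVatsal2000, §2 Prop. (2.4) (proof)] -/
theorem natCard_invariants_eq_natCard_hom (Hi : Subgroup (absoluteGaloisGroup F))
    (hle : absInertia F ≤ Hi) (hunr : ∀ σ ∈ absInertia F, ∀ b : B, σ • b = b) :
    Nat.card {y : continuousCohomology 1 (subgroupRep (discreteTopRep Hi B)
        ((absInertia F).subgroupOf Hi)) //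
        ∀ h : Hi, conjMap (discreteTopRep Hi B) ((absInertia F).subgroupOf Hi) h 1 y = y} =
      Nat.card {f : absInertia F → B // (Continuous f ∧ ∀ x y, f (x * y) = f x + f y) ∧
        ∀ h : absoluteGaloisGroup F, h ∈ Hi → ∀ x : absInertia F,
          h • f ⟨h⁻¹ * x * h, (absInertia.normal (F := F)).conj_mem' x x.2 h⟩ = f x} := by
  -- notation
  let G : Type := absoluteGaloisGroup F
  let I : Subgroup G := absInertia F
  let N : Subgroup Hi := I.subgroupOf Hi
  let X : TopRep ℤ Hi := discreteTopRep Hi B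
  let XN : TopRep ℤ N := subgroupRep X N
  have htriv : ∀ (g : N) (b : XN), XN.ρ g b = b := fun g b ↦
    hunr ((g : Hi) : G) (Subgroup.mem_subgroupOf.mp g.2) b
  -- `I ≃ N` on elements
  let eN : I → N := fun x ↦ ⟨⟨x.1, hle x.2⟩, Subgroup.mem_subgroupOf.mpr x.2⟩
  have heN : Continuous eN := (continuous_subtype_val.subtype_mk _).subtype_mk _
  let eI : N → I := fun x ↦ ⟨x.1.1, Subgroup.mem_subgroupOf.mp x.2⟩
  have heI : Continuous eI := (continuous_subtype_val.comp continuous_subtype_val).subtype_mk _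
  -- cocycle attached to a continuous homomorphism
  let coc : {f : I → B // Continuous f ∧ ∀ x y, f (x * y) = f x + f y} → contOneCocycles XN :=
    fun f ↦ ⟨⟨fun x ↦ f.1 (eI x), f.2.1.comp heI⟩, fun g h ↦ by
      show f.1 (eI (g * h)) = f.1 (eI g) + XN.ρ g (f.1 (eI h))
      rw [htriv]
      exact f.2.2 (eI g) (eI h)⟩
  have hcoc : ∀ f x, (coc f).1 x = f.1 (eI x) := fun _ _ ↦ rfl
  -- invariance of the class of `coc f` under `h ∈ Hi`
  have hinv : ∀ (f : {f : I → B // Continuous f ∧ ∀ x y, f (x * y) = f x + f y}) (h : Hi),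
      conjMap X N h 1 (oneCocycleClass XN (coc f)) = oneCocycleClass XN (coc f) ↔
        ∀ x : I, (h : G) • f.1 ⟨(h : G)⁻¹ * x * h, (absInertia.normal (F := F)).conj_mem' x x.2 h⟩ =
          f.1 x := by
    intro f h
    rw [conjMap_oneCocycleClass, (oneCocycleClass_injective_of_trivial XN htriv).eq_iff]
    constructor
    · intro heq x
      exact congrArg (fun φ : contOneCocycles XN ↦ φ.1 (eN x)) heq
    · intro hx
      apply Subtype.ext
      ext y
      rw [conj_pullback_apply, hcoc, hcoc]
      exact hx (eI y)
  -- the bijection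
  refine Nat.card_congr (Equiv.ofBijective
    (fun f ↦ ⟨oneCocycleClass XN (coc ⟨f.1, f.2.1⟩),
      fun h ↦ (hinv ⟨f.1, f.2.1⟩ h).mpr (f.2.2 h h.2)⟩) ⟨?_, ?_⟩).symm
  · -- injective
    rintro ⟨f, hf, hfi⟩ ⟨f', hf', hfi'⟩ hff'
    have hcl : oneCocycleClass XN (coc ⟨f, hf⟩) = oneCocycleClass XN (coc ⟨f', hf'⟩) :=
      congrArg Subtype.val hff'
    have hc := oneCocycleClass_injective_of_trivial XN htriv hcl
    apply Subtype.ext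
    funext x
    exact congrArg (fun φ : contOneCocycles XN ↦ φ.1 (eN x)) hc
  · -- surjective
    rintro ⟨y, hy⟩
    obtain ⟨φ, rfl⟩ := oneCocycleClass_surjective XN y
    let f : I → B := fun x ↦ φ.1 (eN x)
    have hf : Continuous f ∧ ∀ x y, f (x * y) = f x + f y :=
      ⟨φ.1.continuous.comp heN, fun x y ↦ by
        show φ.1 (eN (x * y)) = φ.1 (eN x) + φ.1 (eN y)
        rw [← contOneCocycles.apply_mul_of_trivial htriv φ]
        rfl⟩
    have hφ : coc ⟨f, hf⟩ = φ := Subtype.ext (ContinuousMap.ext fun x ↦ rfl)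
    refine ⟨⟨f, hf, fun h hh ↦ ?_⟩, Subtype.ext ?_⟩
    · have := hy ⟨h, hh⟩
      rw [← hφ] at this
      exact (hinv ⟨f, hf⟩ ⟨h, hh⟩).mp this
    · show oneCocycleClass XN (coc ⟨f, hf⟩) = oneCocycleClass XN φ
      rw [hφ]

end Local

/-! ### §2 The count over a `ℤ_p`-extension -/

variable {K : Type} [Field K] [NumberField K] {v : HeightOneSpectrum (𝓞 K)} {p : ℕ} [Fact p.Prime]
  (κ : ZpExtension K p)

/-- **Greenberg–Vatsal Prop. (2.4) for an unramified module.** Let `v ∤ p` be not split completely in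
the `ℤ_p`-extension `κ`, `Hi = Gal(K̄_v/K_{∞,w})`, `B` a finite discrete `p`-primary `Γ_{K_v}`-module
(continuous action) on which the inertia group `I_{K_v}` acts trivially, and `φ` an arithmetic
Frobenius of `K_v`. Then there is `R₀` such that for all `R ≥ R₀`:
**`#H¹(Hi, B) = #{b ∈ B : φ^{p^R} • b = q_v^{p^R} • b}`** (`q_v = residueFieldCard K_v`), i.e.
`H¹(K_{∞,w}, B) ≅ (B(−1))^{Gal(K̄_v/K_{∞,w})}`, the invariants of `B(−1)` under the prime-to-`p` part of
Frobenius. [cite: GreenbergVatsal2000, §2 Prop. (2.4) and proof (arXiv p. 22)]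
[cite: GreenbergLNM1716, §3 Lemma 3.3] [cite: SerreInventiones1972, §1.8 Prop. 6] -/
theorem exists_forall_natCard_subgroupH1_localSubgroup_eq (hpv : (p : 𝓞 K) ∉ v.asIdeal)
    (hns : ∃ σ : absoluteGaloisGroup (v.adicCompletion K),
      σ ∉ localSubgroup κ.kerSubgroup (v.adicCompletion K))
    {B : Type} [AddCommGroup B] [DistribMulAction (absoluteGaloisGroup (v.adicCompletion K)) B]
    [TopologicalSpace B] [DiscreteTopology B] [Finite B] (hB : ∃ k : ℕ, ∀ b : B, p ^ k • b = 0)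
    (hcont : ∀ b : B, Continuous fun g : absoluteGaloisGroup (v.adicCompletion K) ↦ g • b)
    (hunr : ∀ σ ∈ absInertia (v.adicCompletion K), ∀ b : B, σ • b = b)
    {φ : absoluteGaloisGroup (v.adicCompletion K)} (hφ : IsFrobPow φ 1) :
    ∃ R₀ : ℕ, ∀ R : ℕ, R₀ ≤ R →
      Nat.card (Literature.NumberTheory.EllipticCurves.subgroupH1
          (localSubgroup κ.kerSubgroup (v.adicCompletion K)) B) =
        Nat.card {b : B // φ ^ p ^ R • b = (residueFieldCard (v.adicCompletion K) ^ p ^ R) • b} := by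
  -- notation
  let Fv := v.adicCompletion K
  let G : Type := absoluteGaloisGroup Fv
  let Hi : Subgroup G := localSubgroup κ.kerSubgroup Fv
  let I : Subgroup G := absInertia Fv
  haveI : CharZero Fv := charZero_of_injective_algebraMap (algebraMap K Fv).injective
  haveI := absoluteGaloisGroup_compactSpace Fv
  have hp : (p : ℕ).Prime := Fact.out
  have hℓ : ringChar 𝓀[Fv] ≠ p := v.ringChar_residueField_adicCompletion_ne hpv
  have hle : I ≤ Hi := absInertia_le_localSubgroup κ hpv
  -- `#B` is a power of `p`, hence prime to the residue characteristic
  have hBp : ∀ b : B, ∃ k : ℕ, p ^ k • b = 0 := fun b ↦ by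
    obtain ⟨k, hk⟩ := hB; exact ⟨k, hk b⟩
  have hBcard : (Nat.card B).Coprime (ringChar 𝓀[Fv]) := by
    have hP : IsPGroup p (Multiplicative B) := fun g ↦ by
      obtain ⟨k, hk⟩ := hBp g.toAdd
      exact ⟨k, Multiplicative.toAdd.injective (by rw [toAdd_pow, toAdd_one]; exact hk)⟩
    obtain ⟨n, hn⟩ := (IsPGroup.iff_card).mp hP
    have hn' : Nat.card B = p ^ n := hn
    rw [hn']
    exact Nat.Coprime.pow_left n ((Nat.coprime_primes hp (ringChar_residueField_prime (F := Fv))).2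
      (Ne.symm hℓ))
  -- the continuous homomorphisms `I → B` and their twisted stabilisers
  let E : Type := {f : I → B // Continuous f ∧ ∀ x y, f (x * y) = f x + f y}
  let cj : G → I → I := fun g x ↦ ⟨g⁻¹ * x * g, (absInertia.normal (F := Fv)).conj_mem' x x.2 g⟩
  have hcj_coe : ∀ g x, ((cj g x : I) : G) = g⁻¹ * x * g := fun _ _ ↦ rfl
  have hfcongr : ∀ (f : E) (x y : I), (x : G) = y → f.1 x = f.1 y := fun f x y h ↦ by
    rw [Subtype.ext h]
  have hf_one : ∀ f : E, f.1 1 = 0 := fun f ↦ by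
    have h := f.2.2 1 1
    rw [mul_one] at h
    exact left_eq_add.mp h
  have hf_inv : ∀ (f : E) (x : I), f.1 x⁻¹ = -f.1 x := fun f x ↦ by
    have h := f.2.2 x x⁻¹
    rw [mul_inv_cancel, hf_one] at h
    exact (neg_eq_of_add_eq_zero_right h.symm).symm
  let S : E → Subgroup G := fun f ↦
    { carrier := {g | ∀ x : I, g • f.1 (cj g x) = f.1 x}
      one_mem' := fun x ↦ by
        rw [one_smul]
        exact hfcongr f _ _ (by simp only [hcj_coe]; group)
      mul_mem' := fun {a b} ha hb x ↦ by
        have hab : f.1 (cj (a * b) x) = f.1 (cj b (cj a x)) :=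
          hfcongr f _ _ (by simp only [hcj_coe]; group)
        rw [hab, mul_smul, hb (cj a x), ha x]
      inv_mem' := fun {a} ha x ↦ by
        have h := ha (cj a⁻¹ x)
        have hx : f.1 (cj a (cj a⁻¹ x)) = f.1 x :=
          hfcongr f _ _ (by simp only [hcj_coe]; group)
        rw [hx] at h
        rw [← h, ← mul_smul, inv_mul_cancel, one_smul] }
  have hS : ∀ (f : E) (g : G), g ∈ S f ↔ ∀ x : I, g • f.1 (cj g x) = f.1 x := fun _ _ ↦ Iff.rfl
  -- `I ≤ S_f`
  have hIS : ∀ f : E, I ≤ S f := fun f i hi x ↦ by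
    rw [hunr i hi, show cj i x = ⟨i, hi⟩⁻¹ * x * ⟨i, hi⟩ from rfl, f.2.2, f.2.2, hf_inv]
    abel
  -- `E` is finite: evaluation at a tame `p`-generator is injective
  obtain ⟨σ₀, -, hσ₀⟩ := exists_absInertia_tame_generator.{0, 0, 0} Fv hp hℓ
  obtain ⟨hinj, hsurj⟩ := hσ₀ B hBp
  let ev : E → B := fun f ↦ f.1 σ₀
  have hev_inj : Function.Injective ev := by
    intro f f' h
    apply Subtype.ext
    funext x
    have h0 := hinj (fun x ↦ f.1 x - f'.1 x) (f.2.1.sub f'.2.1)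
      (fun x y ↦ by rw [f.2.2, f'.2.2]; abel) (sub_eq_zero.mpr h) x
    exact sub_eq_zero.mp h0
  have hev_bij : Function.Bijective ev := ⟨hev_inj, fun b ↦ by
    obtain ⟨f, hf, hadd, hfb⟩ := hsurj b
    exact ⟨⟨f, hf, hadd⟩, hfb⟩⟩
  haveI : Finite E := Finite.of_injective ev hev_inj
  -- a common open normal `N₀ ≤ S_f`
  haveI : CompactSpace I :=
    isCompact_iff_compactSpace.mp (isClosed_absInertia_holds Fv).isCompact
  obtain ⟨N₀, hN₀⟩ : ∃ N₀ : OpenNormalSubgroup G, ∀ f : E, N₀.toSubgroup ≤ S f := by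
    have hV : ∀ f : E, ∃ V ∈ 𝓝 (1 : G), ∀ g ∈ V, ∀ x : I, f.1 (cj g x) = f.1 x := fun f ↦ by
      obtain ⟨V, hV, hVf⟩ := exists_nhds_one_forall_eq' (X := I) (P := G) (fun x g ↦ f.1 (cj g x))
        (f.2.1.comp (Continuous.subtype_mk
          (((continuous_snd.inv).mul (continuous_subtype_val.comp continuous_fst)).mul
            continuous_snd) _))
      refine ⟨V, hV, fun g hg x ↦ ?_⟩
      rw [hVf x g hg]
      exact hfcongr f _ _ (by simp only [hcj_coe]; group)
    choose V hV hVf using hV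
    have hstab : ∀ b : B, {g : G | g • b = b} ∈ 𝓝 (1 : G) := fun b ↦
      ((isOpen_discrete ({b} : Set B)).preimage (hcont b)).mem_nhds (by
        show (1 : G) • b ∈ ({b} : Set B)
        rw [one_smul]; rfl)
    have hW : ((⋂ f, V f) ∩ ⋂ b : B, {g : G | g • b = b}) ∈ 𝓝 (1 : G) :=
      Filter.inter_mem (Filter.iInter_mem.2 hV) (Filter.iInter_mem.2 hstab)
    obtain ⟨N₀, hN₀⟩ := ProfiniteGrp.exist_openNormalSubgroup_sub_open_nhds_of_one isOpen_interior
      (mem_interior_iff_mem_nhds.2 hW)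
    have hN₀' : (N₀ : Set G) ⊆ (⋂ f, V f) ∩ ⋂ b : B, {g : G | g • b = b} :=
      hN₀.trans interior_subset
    refine ⟨N₀, fun f g hg x ↦ ?_⟩
    have hg' := hN₀' hg
    rw [(Set.mem_iInter.mp hg'.2) (f.1 (cj g x)), hVf f g (Set.mem_iInter.mp hg'.1 f) x]
  -- Frobenius reduction
  obtain ⟨R₀, hR₀⟩ := exists_forall_localSubgroup_le_iff_pow_mem κ hpv hns hφ N₀.toSubgroup N₀.isOpen'
  refine ⟨R₀, fun R hR ↦ ?_⟩
  -- the twist: `φ^{p^R} ∈ S_f ↔ φ^{p^R} • f σ₀ = q^{p^R} • f σ₀`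
  have hτ : IsFrobPow (φ ^ p ^ R) ((p ^ R : ℕ) : ℤ) := by
    have h := hφ.pow (p ^ R)
    rwa [mul_one] at h
  have htwist : ∀ f : E, φ ^ p ^ R ∈ S f ↔
      φ ^ p ^ R • f.1 σ₀ = (residueFieldCard Fv ^ p ^ R) • f.1 σ₀ := by
    intro f
    -- `τ • f σ = f (τ σ τ⁻¹) = q^{p^R} • f σ` reformulated through `cj`
    have key : ∀ σ : I, f.1 (cj (φ ^ p ^ R)⁻¹ σ) = (residueFieldCard Fv ^ p ^ R) • f.1 σ := by
      intro σ
      have hconj : φ ^ p ^ R * (σ : G) * (φ ^ p ^ R)⁻¹ ∈ I :=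
        (absInertia.normal (F := Fv)).conj_mem _ σ.2 _
      rw [← apply_conj_eq_pow_nsmul_of_isFrobPow Fv hBcard f.1 f.2.2 f.2.1 hτ σ hconj]
      exact hfcongr f _ _ (by rw [hcj_coe, inv_inv])
    rw [hS]
    constructor
    · intro h
      have h1 := h (cj (φ ^ p ^ R)⁻¹ σ₀)
      have hx : f.1 (cj (φ ^ p ^ R) (cj (φ ^ p ^ R)⁻¹ σ₀)) = f.1 σ₀ :=
        hfcongr f _ _ (by simp only [hcj_coe]; group)
      rw [hx, key] at h1
      exact h1
    · intro h x
      -- `τ • f σ = q^{p^R} • f σ` for every `σ`: the difference is a continuous homomorphism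
      -- vanishing at the tame generator `σ₀`
      have hall : ∀ σ : I, φ ^ p ^ R • f.1 σ = (residueFieldCard Fv ^ p ^ R) • f.1 σ := fun σ ↦
        sub_eq_zero.mp (hinj (fun σ ↦ φ ^ p ^ R • f.1 σ - (residueFieldCard Fv ^ p ^ R) • f.1 σ)
          (((continuous_of_discreteTopology (f := fun b : B ↦ φ ^ p ^ R • b)).comp
            f.2.1).sub ((continuous_of_discreteTopology (f :=
              fun b : B ↦ (residueFieldCard Fv ^ p ^ R) • b)).comp f.2.1))
          (fun σ σ' ↦ by
            show φ ^ p ^ R • f.1 (σ * σ') - (residueFieldCard Fv ^ p ^ R) • f.1 (σ * σ') = _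
            rw [f.2.2, smul_add, smul_add]
            abel)
          (sub_eq_zero.mpr h) σ)
      rw [hall, ← key]
      exact hfcongr f _ _ (by simp only [hcj_coe]; group)
  -- assemble
  haveI : (absInertia Fv).Normal := absInertia.normal (F := Fv)
  rw [natCard_subgroupH1_localSubgroup_eq_natCard_invariants κ hpv hns hB hBcard hcont,
    natCard_invariants_eq_natCard_hom Hi hle hunr]
  -- `{f // Hi ≤ S_f} ≃ {f // φ^{p^R} ∈ S_f} ≃ {f // condition at σ₀} ≃ {b // condition}`
  have e1 : {f : I → B // (Continuous f ∧ ∀ x y, f (x * y) = f x + f y) ∧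
      ∀ h : G, h ∈ Hi → ∀ x : I, h • f ⟨h⁻¹ * x * h, (absInertia.normal (F := Fv)).conj_mem' x x.2 h⟩ = f x} ≃
      {f : E // φ ^ p ^ R • f.1 σ₀ = (residueFieldCard Fv ^ p ^ R) • f.1 σ₀} :=
    { toFun := fun f ↦ ⟨⟨f.1, f.2.1⟩, (htwist ⟨f.1, f.2.1⟩).mp
        (((hR₀ R hR (S ⟨f.1, f.2.1⟩) (hIS _) (hN₀ _)).mp fun h hh ↦ f.2.2 h hh))⟩
      invFun := fun f ↦ ⟨f.1.1, f.1.2, fun h hh ↦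
        (hR₀ R hR (S f.1) (hIS _) (hN₀ _)).mpr ((htwist f.1).mpr f.2) hh⟩
      left_inv := fun _ ↦ rfl
      right_inv := fun _ ↦ rfl }
  exact (Nat.card_congr e1).trans
    (Nat.card_congr ((Equiv.ofBijective ev hev_bij).subtypeEquiv fun f ↦ Iff.rfl))

end Summit.BirchSwinnertonDyer.BirchSwinnertonDyer.Theorems.UniversalToricDescentUnramifiedLocalCount

end
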